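import Literature.MathematicalPhysics.QuantumFieldTheory.O2ChargedSectorsTermwise
import Literature.MathematicalPhysics.QuantumFieldTheory.ConformalBootstrap3D.BlockZSeriesABGeneral
import Literature.MathematicalPhysics.QuantumFieldTheory.ConformalBootstrap3D.DoPochHalfFactor
import HarnessLib

/-!
# O(2) scan, the charged `2 × 2` sector `2⁺`: domination, the rank-one coefficient structure and the termwise rule

The charge-`2` even-spin condition of the O(2) three-scalar scan (`O2ScanObligations.Pos2p`):
`α(V⃗_{2⁺,Δ,ℓ}[g]) ⪰ 0`, a `2 × 2` matrix in the basis `(b, z) = (λ_{φφ𝒪}, λ_{ts𝒪})`, with FOUR block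
families of three different orderings — `φφφφ` (`g^{0,0}`, rows `2b²F⁻_{Δφ}`, `2b²F⁺_{Δφ}`), `tsts`
(`g^{d′,d′}`, `d′ = Δ_t − Δ_s`, row `2z²F⁻_{(Δs+Δt)/2}`, SIGN-INDEFINITE block), `stts` (`g^{−d′,d′}`, rows
`2z²F⁻_{Δt}`, `−2z²F⁺_{Δt}`) and `φφst` (`g^{0,−d′}`, rows `2bz F⁻_{(Δφ+Δs)/2}`, `−2bz F⁺`) (tree rows
`1, 2, 14, 15, 16, 20, 21` of `O2ThreeScalarCrossing.quad2p_eq`).  Three inputs make a TERMWISE test of this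
matrix condition possible:

* the Cauchy–Schwarz domination of the `tsts` row by the two-weight evaluation of `g^{−d′,d′}`
  (`O2ChargedSectorsTermwise.abs_nodeEval_crossF_gmm_le`, the SAME dominating evaluation `dom2mEval` as
  sector `2⁻` — the row enters `2⁺` with `+2F⁻` and `2⁻` with `−2F⁻`, and the budget is sign-blind), so that
  `(b z) α(V⃗_{2⁺}[g]) (b;z) ≥ 𝔇₂₊(b, z) := b²·P[G_{φφφφ}] + z²·𝔇₂₋[G_{stts}] + bz·Q[G_{φφst}]`
  (`dom2pForm_le_sector2pForm`);
* CONJUGATION ALIGNMENT of the off-diagonal block: by the Dolan–Osborn conjugation symmetry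
  (`BlockConjugationSymmetry`: `v^{(Δ₃₄−Δ₁₂)/2} g^{Δ₁₂,Δ₃₄} = g^{−Δ₁₂,−Δ₃₄}`, `IsConformalBlock3D.conj`) and the
  node identity `F^{s}_{σ}[v^{α}H] = F^{s+α}_{σ}[H]` (`crossF_conjBlock`), the entry `Q[G_{φφst}]`
  (`G_{φφst} = g^{0,−d′}`) equals the SHIFTED functional `Q♮[H♮]` (`qForm2pA`, crossing exponent
  `(Δφ+Δs)/2 + d′/2 = (Δφ+Δt)/2`) of the conjugated block `H♮ = v^{−d′/2}G_{φφst} = g^{0,d′}`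
  (`qForm2p_eq_qForm2pA`), expanded by the `(n,j)` double series of a block of ARBITRARY ordering
  (`BlockZSeriesABGeneral`) with coefficients `A_{n,j}(0, d′/2)`;
* the RANK-ONE structure `A_{n,j}(a,b) = A_{n,j}(0,0) ρ(a) ρ(b)` of the Dolan–Osborn coefficients
  (`DoPochHalfFactor.hrCoeffAB_eq_hrCoeff_mul_doPochRatio`): after alignment the three coefficient families
  `A(0,0)`, `A(0,d′/2) = A(0,0)ρ₊`, `A(d′/2,d′/2) = A(0,0)ρ₊²` carry ONE Pochhammer ratio `ρ₊ = ρ(d′/2)`, so that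
  `𝔇₂₊(b,z) = Σ_{(n,j)} (A_{n,j}(0,0)/λ_ℓ) · 𝔗_{n,j}(b,z)` with the TERM FORM
  `𝔗_{n,j}(b,z) = b²·P[𝒫_{Δ+n,j}] + z²·ρ₊²·𝔇₂₋[𝒫_{Δ+n,j}] + bz·ρ₊·Q♮[𝒫_{Δ+n,j}]
   = (b, ρ₊z) M_{n,j} (b, ρ₊z)ᵀ`, `M_{n,j} = [[P, Q♮/2], [Q♮/2, 𝔇₂₋]]` built from KERNEL VALUES ONLY
  (`hasSum_dom2pForm`): the per-term test `P ≥ 0, 𝔇₂₋ ≥ 0, Q♮² ≤ 4P𝔇₂₋` is free of Pochhammer ratios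
  (`dom2pTermForm_nonneg_of_test`).

Contents: §1 the sector form `sector2pForm` and the dictionary `(b z) α(V⃗_{2⁺}[g]) (b;z) = sector2pForm`
(`sector2pForm_eq`), the blocks of a genuine family, and the conjugation alignment (`crossF_conjBlock`,
`qForm2pA`, `qForm2p_eq_qForm2pA`); §2 the dominated form `dom2pForm ≤ sector2pForm`;
§3 the term form, the series `hasSum_dom2pForm` and the TERMWISE RULE `pos2p_of_dom_termwise` (finite head
`Σ_{q ∈ S} (A_q(0,0)/λ) 𝔗_q(b,z) ≥ 0` for all `(b,z)` + every tail term form `≥ 0` for all `(b,z)` ⇒ `Pos2p` at a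
regular point above the bound, `Δ ≠ 1` if `ℓ = 0`), with the binary-form test `binForm_nonneg`
(`A ≥ 0, C ≥ 0, B² ≤ 4AC ⇒ A b² + B bz + C z² ≥ 0`) as the client's per-term check; §4 NON-REGULAR points by
right limits (`pos2p_of_eventually_right`).

R-07.5 PLANNING for the O(2) client path; no numerics.  HONEST SCOPE: a one-sided SUFFICIENT condition —
the `tsts` row is discarded by Cauchy–Schwarz exactly as in sectors `3`, `2⁻` and the `σ–ε` odd sector, and
termwise positive-semidefiniteness of the `M_{n,j}` is stronger than positive-semidefiniteness of the
sum; thanks to the alignment the per-term test involves kernel values only, so box rules in `Δ` and a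
uniform tail rule by apex asymptotics are available exactly as for the neutral sectors (separate files);
the point `(Δ, ℓ) = (1, 0)` is outside the estimate and is reached by no rule of this file; the other
`2 × 2` charged sector (charge `1`, six labels) is not treated here.
DECLARATIONS: definitions `pForm2p`, `rForm2p`, `qForm2p`, `qForm2pA`, `sector2pForm`, `dom2pForm`,
`rhoPlus2p`, `dom2pTermForm`.

References: Chester–Landry–Liu–Poland–Simmons-Duffin–Su–Vichi, JHEP 06 (2020) 142, §2.1, §3.1, App.
«Crossing vectors» (`ChesterEtAl2020`); Kos–Poland–Simmons-Duffin, JHEP 11 (2014) 109, §3.3 eq. (3.16),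
§4 eqs. (4.2)–(4.3) (`KosPolandSimmonsduffin2014`); Pappadopulo–Rychkov–Espin–Rattazzi, Phys. Rev. D 86
(2012) 105043, §5 (`PappadopuloRychkovEspinRattazzi2012`); Dolan–Osborn, Nucl. Phys. B 678 (2004) 491,
§3 eqs. (3.10)–(3.11) (`DolanOsborn2004`); Dolan–Osborn, arXiv:1108.6194, §2 eqs. (2.43)–(2.44)
(`DolanOsborn2011`); Hogervorst–Rychkov, Phys. Rev. D 87 (2013) 106004, §3 eqs. (3.6)–(3.9)
(`HogervorstRychkov2013`).
-/

namespace Literature.MathematicalPhysics.QuantumFieldTheory.O2ChargeTwoEvenTermwise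

open Finset Set Matrix Filter Topology
open Literature.MathematicalPhysics.QuantumFieldTheory.O2ThreeScalarCrossing
open Literature.MathematicalPhysics.QuantumFieldTheory.O2ThreeScalarSystem
open Literature.MathematicalPhysics.QuantumFieldTheory.O2OPEScanBridge
open Literature.MathematicalPhysics.QuantumFieldTheory.O2ScanObligations
open Literature.MathematicalPhysics.QuantumFieldTheory.O2NeutralSectorsTermwise
open Literature.MathematicalPhysics.QuantumFieldTheory.O2ChargedSectorsTermwise
open ConformalBootstrap3D (IsConformalBlock3D IsConformalBlock3DAbove IsRegularPoint3D unitarityBound3D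
  accidentalDegeneracy3D crossF pointFunctional pointFunctional_apply zMono legendreLam legendreLam_pos
  InDescendantRange hrCoeff hrCoeffAB hrCoeff_nonneg hrCoeff_eq_zero_of_not_inDescendantRange
  hrCoeffAB_zero_zero doPochFactor doPochFactor_zero_zero_pos doPochHalf doPochRatio doPochRatio_zero
  doPochHalf_zero_ne_zero hrCoeffAB_eq_hrCoeff_mul_doPochRatio
  hasSum_pointFunctional_crossF_hrZ hasSum_pointFunctional_crossF_hrZAB_general
  tendsto_pointFunctional_crossF twoWeightEval conjBlock)

/-! ### §1 The `2⁺` sector form at the `z`-level and the dictionary -/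

/-- The `φφφφ` entry of `V⃗_{2⁺}`: `P[H] = 2Φ₁[F⁻_{Δφ}H] + 2Φ₂[F⁺_{Δφ}H]` (tree rows `1, 2`).
[cite: ChesterEtAl2020, App. «Crossing vectors» (`V⃗_{2,Δ,ℓ⁺}`)] -/
noncomputable def pForm2p (F : ScanFunctional) (D : Dims) (H : ℝ → ℝ → ℝ) : ℝ :=
  2 * nodeEval F 1 (crossF (D.expo .φφφφ) (-1) H) + 2 * nodeEval F 2 (crossF (D.expo .φφφφ) 1 H)

/-- The `ts`–`ts` entry of `V⃗_{2⁺}`: `R[G] = 2Φ₁₄[F⁻_{(Δs+Δt)/2}G_{tsts}] + 2Φ₁₅[F⁻_{Δt}G_{stts}] − 2Φ₁₆[F⁺_{Δt}G_{stts}]`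
(tree rows `14, 15, 16`). [cite: ChesterEtAl2020, App. «Crossing vectors» (`V⃗_{2,Δ,ℓ⁺}`)] -/
noncomputable def rForm2p (F : ScanFunctional) (D : Dims) (G : Label → ℝ → ℝ → ℝ) : ℝ :=
  2 * nodeEval F 14 (crossF (D.expo .tsts) (-1) (G .tsts)) +
      2 * nodeEval F 15 (crossF (D.expo .stts) (-1) (G .stts)) -
    2 * nodeEval F 16 (crossF (D.expo .stts) 1 (G .stts))

/-- The off-diagonal entry of `V⃗_{2⁺}` (doubled): `Q[H] = 2Φ₂₀[F⁻_{(Δφ+Δs)/2}H] − 2Φ₂₁[F⁺_{(Δφ+Δs)/2}H]`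
(tree rows `20, 21`). [cite: ChesterEtAl2020, App. «Crossing vectors» (`V⃗_{2,Δ,ℓ⁺}`)] -/
noncomputable def qForm2p (F : ScanFunctional) (D : Dims) (H : ℝ → ℝ → ℝ) : ℝ :=
  2 * nodeEval F 20 (crossF (D.expo .φφst) (-1) H) - 2 * nodeEval F 21 (crossF (D.expo .φφst) 1 H)

/-- **The `2⁺` sector form** of a scan functional on a family `G` of `z`-coordinate functions, basis
`(b, z) = (λ_{φφ𝒪}, λ_{ts𝒪})`: `b²·P[G_{φφφφ}] + z²·R[G] + bz·Q[G_{φφst}]`.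
[cite: ChesterEtAl2020, App. «Crossing vectors» (`V⃗_{2,Δ,ℓ⁺}`)] -/
noncomputable def sector2pForm (F : ScanFunctional) (D : Dims) (G : Label → ℝ → ℝ → ℝ) (b z : ℝ) : ℝ :=
  b ^ 2 * pForm2p F D (G .φφφφ) + z ^ 2 * rForm2p F D G + b * z * qForm2p F D (G .φφst)

/-- **Dictionary, sector `2⁺`**: `(b z) α(V⃗_{2⁺}[g]) (b;z)` of a scan functional is the `2⁺` sector form of
the `z`-coordinate blocks. Bookkeeping over the printed `V⃗_{2⁺}`.
[cite: ChesterEtAl2020, App. «Crossing vectors» (`V⃗_{2,Δ,ℓ⁺}`), §3.1 (functional conditions)] -/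
theorem sector2pForm_eq (F : ScanFunctional) (D : Dims) (g : Label → ℝ → ℝ → ℝ) (b z : ℝ) :
    ![b, z] ⬝ᵥ (alphaMat F.toFunctional (V2p D g) *ᵥ ![b, z]) =
      sector2pForm F D (fun L => pullbackZ (g L)) b z := by
  rw [alphaMat_quadForm, show quadVec ![b, z] (V2p D g) = quad2p D b z g from rfl,
    ScanFunctional.toFunctional, pointFunctional₂₂_apply]
  have hnode : ∀ m : Fin F.M, ∑ r, F.w m r * quad2p D b z g (F.u m) (F.v m) r =
      b ^ 2 * (2 * (F.w m 1 * crossF (D.expo .φφφφ) (-1) (pullbackZ (g .φφφφ)) (F.z m) (F.zb m)) +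
          2 * (F.w m 2 * crossF (D.expo .φφφφ) 1 (pullbackZ (g .φφφφ)) (F.z m) (F.zb m))) +
        z ^ 2 * (2 * (F.w m 14 * crossF (D.expo .tsts) (-1) (pullbackZ (g .tsts)) (F.z m) (F.zb m)) +
            2 * (F.w m 15 * crossF (D.expo .stts) (-1) (pullbackZ (g .stts)) (F.z m) (F.zb m)) -
          2 * (F.w m 16 * crossF (D.expo .stts) 1 (pullbackZ (g .stts)) (F.z m) (F.zb m))) +
        b * z * (2 * (F.w m 20 * crossF (D.expo .φφst) (-1) (pullbackZ (g .φφst)) (F.z m) (F.zb m)) -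
          2 * (F.w m 21 * crossF (D.expo .φφst) 1 (pullbackZ (g .φφst)) (F.z m) (F.zb m))) := by
    intro m
    rw [sum_univ_fin22, quad2p_eq]
    simp only [ScanFunctional.u, ScanFunctional.v, Fminus_pullbackZ, Fplus_pullbackZ]
    simp
    ring
  rw [Finset.sum_congr rfl fun m _ => hnode m]
  simp only [sector2pForm, pForm2p, rForm2p, qForm2p, nodeEval_apply, Finset.mul_sum,
    ← Finset.sum_add_distrib, ← Finset.sum_sub_distrib]

/-- The blocks of a family genuine on `labels2p`, in `z`-coordinates: `G_L = g^{Δ_ij(L),Δ_kl(L)}_{Δ,ℓ}`.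
[cite: ChesterEtAl2020, §2.1 (`F^{ij,kl}_{∓,Δ,ℓ}`)] -/
theorem blocks_of_genuineOn_labels2p {D : Dims} {Δ : ℝ} {ℓ : ℕ} {g : Label → ℝ → ℝ → ℝ}
    (hg : GenuineOn D labels2p Δ ℓ g) :
    ∀ L ∈ labels2p, IsConformalBlock3D (d12 D L) (d34 D L) Δ ℓ (pullbackZ (g L)) :=
  fun L hL => hg L hL

/-- The four orderings on `labels2p`: `φφφφ ↦ (0,0)`, `tsts ↦ (d′,d′)`, `stts ↦ (−d′,d′)`, `φφst ↦ (0,−d′)`,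
`d′ = Δ_t − Δ_s`. Bookkeeping. [cite: ChesterEtAl2020, §2.1 (`F^{ij,kl}_{∓,Δ,ℓ}`)] -/
theorem blocks2p_of_forall {D : Dims} {Δ : ℝ} {ℓ : ℕ} {G : Label → ℝ → ℝ → ℝ}
    (hG : ∀ L ∈ labels2p, IsConformalBlock3D (d12 D L) (d34 D L) Δ ℓ (G L)) :
    IsConformalBlock3D 0 0 Δ ℓ (G .φφφφ) ∧
      IsConformalBlock3D (D.Δt - D.Δs) (D.Δt - D.Δs) Δ ℓ (G .tsts) ∧
      IsConformalBlock3D (-(D.Δt - D.Δs)) (D.Δt - D.Δs) Δ ℓ (G .stts) ∧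
      IsConformalBlock3D 0 (-(D.Δt - D.Δs)) Δ ℓ (G .φφst) := by
  have h₀ := hG .φφφφ (by simp [labels2p])
  have h₁ := hG .tsts (by simp [labels2p])
  have h₂ := hG .stts (by simp [labels2p])
  have h₃ := hG .φφst (by simp [labels2p])
  simp only [d12, d34] at h₀ h₁ h₂ h₃
  have hre : D.Δs - D.Δt = -(D.Δt - D.Δs) := by ring
  rw [hre] at h₂ h₃
  exact ⟨h₀, h₁, h₂, h₃⟩

/-! ### §1b Conjugation alignment of the off-diagonal block

In the tree `conjBlock α g = v^α·g`, `v = (1-x)(1-y)`, and `IsConformalBlock3D.conj` types `v^{(Δ₃₄−Δ₁₂)/2} g` as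
`g^{−Δ₁₂,−Δ₃₄}` (Dolan–Osborn 2011 eq. (2.44)).  At a point of the open square the crossing combination
absorbs the prefactor into its exponent, `F^{s}_{σ}[v^{α}H] = F^{s+α}_{σ}[H]` (the reflected point turns `v`
into `u`), so `Q[G_{φφst}] = Q♮[v^{−d′/2} G_{φφst}]` with the shifted exponent `(Δφ+Δs)/2 + d′/2`, and
`v^{−d′/2} G_{φφst} = g^{0,d′}` has the coefficient family `A_{n,j}(0, d′/2) = A_{n,j}(0,0)·ρ(d′/2)`. -/

/-- **`F^{s}_{σ}[v^{α} g] = F^{s+α}_{σ}[g]` on the open square.** [cite: DolanOsborn2011, §2 eqs. (2.43)–(2.44)]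
[cite: KosPolandSimmonsduffin2014, §3.1 eq. (3.8)] -/
theorem crossF_conjBlock (s σ α : ℝ) (g : ℝ → ℝ → ℝ) {x y : ℝ} (hx : x ∈ Ioo (0 : ℝ) 1)
    (hy : y ∈ Ioo (0 : ℝ) 1) : crossF s σ (conjBlock α g) x y = crossF (s + α) σ g x y := by
  have hv : 0 < (1 - x) * (1 - y) := mul_pos (by linarith [hx.2]) (by linarith [hy.2])
  have hu : 0 < x * y := mul_pos hx.1 hy.1
  simp only [crossF, conjBlock, sub_sub_cancel]
  rw [Real.rpow_add hv, Real.rpow_add hu]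
  ring

/-- At the nodes of a scan functional: `Φ_r[F^{s}_{σ}[v^{α} g]] = Φ_r[F^{s+α}_{σ}[g]]`.
[cite: DolanOsborn2011, §2 eqs. (2.43)–(2.44)] [cite: ChesterEtAl2020, §3.1 (functionals act at points)] -/
theorem nodeEval_crossF_conjBlock (F : ScanFunctional) (r : Fin 22) (s σ α : ℝ) (g : ℝ → ℝ → ℝ) :
    nodeEval F r (crossF s σ (conjBlock α g)) = nodeEval F r (crossF (s + α) σ g) := by
  rw [nodeEval_apply, nodeEval_apply]
  refine Finset.sum_congr rfl fun m _ => ?_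
  rw [crossF_conjBlock s σ α g (F.hz m) (F.hzb m)]

/-- The ALIGNED off-diagonal functional of sector `2⁺`:
`Q♮[H] = 2Φ₂₀[F⁻_{(Δφ+Δs)/2 + d′/2}H] − 2Φ₂₁[F⁺_{(Δφ+Δs)/2 + d′/2}H]` (`(Δφ+Δs)/2 + d′/2 = (Δφ+Δt)/2`), to be applied
to the conjugated block `g^{0,d′}`. [cite: ChesterEtAl2020, App. «Crossing vectors» (`V⃗_{2,Δ,ℓ⁺}`)]
[cite: DolanOsborn2011, §2 eqs. (2.43)–(2.44)] -/
noncomputable def qForm2pA (F : ScanFunctional) (D : Dims) (H : ℝ → ℝ → ℝ) : ℝ :=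
  2 * nodeEval F 20 (crossF (D.expo .φφst + (D.Δt - D.Δs) / 2) (-1) H) -
    2 * nodeEval F 21 (crossF (D.expo .φφst + (D.Δt - D.Δs) / 2) 1 H)

/-- **Alignment identity** `Q[H] = Q♮[v^{−d′/2} H]` for EVERY `H` (node algebra only).
[cite: DolanOsborn2011, §2 eqs. (2.43)–(2.44)] [cite: ChesterEtAl2020, App. «Crossing vectors» (`V⃗_{2,Δ,ℓ⁺}`)] -/
theorem qForm2p_eq_qForm2pA (F : ScanFunctional) (D : Dims) (H : ℝ → ℝ → ℝ) :
    qForm2p F D H = qForm2pA F D (conjBlock (-(D.Δt - D.Δs) / 2) H) := by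
  have e : D.expo .φφst + (D.Δt - D.Δs) / 2 + -(D.Δt - D.Δs) / 2 = D.expo .φφst := by ring
  rw [qForm2p, qForm2pA, nodeEval_crossF_conjBlock, nodeEval_crossF_conjBlock, e]

/-- The conjugated `φφst` block is the typed `g^{0,d′}`. [cite: DolanOsborn2011, §2 eqs. (2.43)–(2.44)] -/
theorem conj_φφst {D : Dims} {Δ : ℝ} {ℓ : ℕ} {H : ℝ → ℝ → ℝ}
    (hH : IsConformalBlock3D 0 (-(D.Δt - D.Δs)) Δ ℓ H) :
    IsConformalBlock3D 0 (D.Δt - D.Δs) Δ ℓ (conjBlock (-(D.Δt - D.Δs) / 2) H) := by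
  have h := hH.conj
  simp only [neg_zero, neg_neg, sub_zero] at h
  exact h

/-! ### §2 The dominated form -/

/-- **The dominated `2⁺` form**: `𝔇₂₊(b,z) = b²·P[G_{φφφφ}] + z²·𝔇₂₋[G_{stts}] + bz·Q[G_{φφst}]` — the `tsts` row
replaced by its Cauchy–Schwarz budget inside `𝔇₂₋ = T(c₂, d₂; Δ_t)` of `O2ChargedSectorsTermwise`.
[cite: PappadopuloRychkovEspinRattazzi2012, §5] [cite: ChesterEtAl2020, App. «Crossing vectors» (`V⃗_{2,Δ,ℓ⁺}`)] -/
noncomputable def dom2pForm (F : ScanFunctional) (D : Dims) (G : Label → ℝ → ℝ → ℝ) (b z : ℝ) : ℝ :=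
  b ^ 2 * pForm2p F D (G .φφφφ) + z ^ 2 * dom2mEval F D (G .stts) + b * z * qForm2p F D (G .φφst)

/-- **`𝔇₂₋[G_{stts}] ≤ R[G]`**: the `tsts` row `+2Φ₁₄[F⁻[g^{d′,d′}]]` is at least minus its Cauchy–Schwarz budget
(regular point above the bound, `Δ ≠ 1` if `ℓ = 0`). [cite: PappadopuloRychkovEspinRattazzi2012, §5] -/
theorem dom2mEval_le_rForm2p (F : ScanFunctional) (D : Dims) {Δ : ℝ} {ℓ : ℕ}
    (hΔ : unitarityBound3D ℓ < Δ) (hreg : ¬ accidentalDegeneracy3D Δ ℓ) (h1 : ℓ = 0 → Δ ≠ 1)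
    {G : Label → ℝ → ℝ → ℝ} (hG₁ : IsConformalBlock3D (D.Δt - D.Δs) (D.Δt - D.Δs) Δ ℓ (G .tsts))
    (hG₂ : IsConformalBlock3D (-(D.Δt - D.Δs)) (D.Δt - D.Δs) Δ ℓ (G .stts)) :
    dom2mEval F D (G .stts) ≤ rForm2p F D G := by
  have h14 := abs_nodeEval_crossF_gmm_le F 14 (σ := -1) (by simp) hΔ hreg h1 hG₁ hG₂ (D.expo .tsts)
  rw [expo_tsts_add_half] at h14
  rw [dom2mEval_eq, rForm2p]
  have a14 := neg_abs_le (nodeEval F 14 (crossF (D.expo .tsts) (-1) (G .tsts)))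
  linarith

/-- **`𝔇₂₊(b,z) ≤ (b z) α(V⃗_{2⁺}) (b;z)`** at the `z`-level, for every `(b, z)`.
[cite: PappadopuloRychkovEspinRattazzi2012, §5] [cite: ChesterEtAl2020, §3.1 (functional conditions)] -/
theorem dom2pForm_le_sector2pForm (F : ScanFunctional) (D : Dims) {Δ : ℝ} {ℓ : ℕ}
    (hΔ : unitarityBound3D ℓ < Δ) (hreg : ¬ accidentalDegeneracy3D Δ ℓ) (h1 : ℓ = 0 → Δ ≠ 1)
    {G : Label → ℝ → ℝ → ℝ} (hG₁ : IsConformalBlock3D (D.Δt - D.Δs) (D.Δt - D.Δs) Δ ℓ (G .tsts))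
    (hG₂ : IsConformalBlock3D (-(D.Δt - D.Δs)) (D.Δt - D.Δs) Δ ℓ (G .stts)) (b z : ℝ) :
    dom2pForm F D G b z ≤ sector2pForm F D G b z := by
  have h := dom2mEval_le_rForm2p F D hΔ hreg h1 hG₁ hG₂
  rw [dom2pForm, sector2pForm]
  nlinarith [sq_nonneg z]

/-! ### §3 The term form, the rank-one coefficient structure and the termwise rule -/

/-- **The client's per-term test**: a real binary form `A b² + B bz + C z²` with `A ≥ 0`, `C ≥ 0`,
`B² ≤ 4AC` is `≥ 0` everywhere. Elementary. [cite: ChesterEtAl2020, §3.1 ("`M ⪰ 0`")] -/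
theorem binForm_nonneg {A B C : ℝ} (hA : 0 ≤ A) (hC : 0 ≤ C) (hB : B ^ 2 ≤ 4 * A * C) (b z : ℝ) :
    0 ≤ A * b ^ 2 + B * (b * z) + C * z ^ 2 := by
  rcases hA.eq_or_lt with hA0 | hA'
  · rw [← hA0] at hB ⊢
    have hB0 : B = 0 := by nlinarith [sq_nonneg B]
    rw [hB0]
    nlinarith [sq_nonneg z]
  · have key : 0 ≤ (2 * A * b + B * z) ^ 2 + (4 * A * C - B ^ 2) * z ^ 2 :=
      add_nonneg (sq_nonneg _) (mul_nonneg (by linarith) (sq_nonneg z))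
    have hid : (4 * A) * (A * b ^ 2 + B * (b * z) + C * z ^ 2) =
        (2 * A * b + B * z) ^ 2 + (4 * A * C - B ^ 2) * z ^ 2 := by ring
    rw [← hid] at key
    exact (mul_nonneg_iff_of_pos_left (by linarith)).mp key

/-- `ρ₊ = ρ(d′/2)` at level `(n,j)`: the ONE Pochhammer ratio of the aligned sector — `A_{n,j}(d′/2,d′/2) =
A_{n,j}(0,0) ρ₊²` (block `g^{−d′,d′}`) and `A_{n,j}(0,d′/2) = A_{n,j}(0,0) ρ₊` (conjugated block `g^{0,d′}`).
[cite: DolanOsborn2004, §3 eq. (3.11)] -/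
noncomputable def rhoPlus2p (D : Dims) (Δ : ℝ) (ℓ n j : ℕ) : ℝ :=
  doPochRatio ((D.Δt - D.Δs) / 2) Δ ℓ n j

/-- **The ALIGNED `2⁺` term form at level `(n,j)`**:
`𝔗_{n,j}(b,z) = b²·P[𝒫_{Δ+n,j}] + z²·ρ₊²·𝔇₂₋[𝒫_{Δ+n,j}] + bz·ρ₊·Q♮[𝒫_{Δ+n,j}] = (b, ρ₊z) M_{n,j} (b, ρ₊z)ᵀ`,
`M_{n,j} = [[P, Q♮/2],[Q♮/2, 𝔇₂₋]]` — an explicit binary form in `(b, z)`: node values of the monomial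
`𝒫_{Δ+n,j}` and ONE rational function `ρ₊` of `Δ`. [cite: HogervorstRychkov2013, §3 eq. (3.9)]
[cite: DolanOsborn2004, §3 eq. (3.11)] [cite: DolanOsborn2011, §2 eqs. (2.43)–(2.44)] -/
noncomputable def dom2pTermForm (F : ScanFunctional) (D : Dims) (Δ : ℝ) (ℓ n j : ℕ) (b z : ℝ) : ℝ :=
  b ^ 2 * pForm2p F D (zMono (Δ + (n : ℝ)) j) +
      z ^ 2 * (rhoPlus2p D Δ ℓ n j ^ 2 * dom2mTerm F D (Δ + (n : ℝ)) j) +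
    b * z * (rhoPlus2p D Δ ℓ n j * qForm2pA F D (zMono (Δ + (n : ℝ)) j))

/-- **The client's per-term test is free of Pochhammer ratios**: `P_q ≥ 0`, `𝔇_q ≥ 0` and `Q♮_q² ≤ 4 P_q 𝔇_q`
(kernel values of `𝒫_{Δ+n,j}` only) give `𝔗_q(b,z) ≥ 0` for all `(b, z)` — because
`𝔗_q(b,z) = (b, ρ₊z) M_q (b, ρ₊z)ᵀ`. [cite: ChesterEtAl2020, §3.1 ("`M ⪰ 0`")] [cite: DolanOsborn2004, §3 eq. (3.11)] -/
theorem dom2pTermForm_nonneg_of_test (F : ScanFunctional) (D : Dims) {Δ : ℝ} {ℓ n j : ℕ}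
    (hA : 0 ≤ pForm2p F D (zMono (Δ + (n : ℝ)) j)) (hC : 0 ≤ dom2mTerm F D (Δ + (n : ℝ)) j)
    (hB : qForm2pA F D (zMono (Δ + (n : ℝ)) j) ^ 2 ≤
      4 * pForm2p F D (zMono (Δ + (n : ℝ)) j) * dom2mTerm F D (Δ + (n : ℝ)) j)
    (b z : ℝ) : 0 ≤ dom2pTermForm F D Δ ℓ n j b z := by
  have hρ := sq_nonneg (rhoPlus2p D Δ ℓ n j)
  have hC' : 0 ≤ rhoPlus2p D Δ ℓ n j ^ 2 * dom2mTerm F D (Δ + (n : ℝ)) j := mul_nonneg hρ hC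
  have hB' : (rhoPlus2p D Δ ℓ n j * qForm2pA F D (zMono (Δ + (n : ℝ)) j)) ^ 2 ≤
      4 * pForm2p F D (zMono (Δ + (n : ℝ)) j) * (rhoPlus2p D Δ ℓ n j ^ 2 * dom2mTerm F D (Δ + (n : ℝ)) j) := by
    have h := mul_le_mul_of_nonneg_left hB hρ
    have e₁ : (rhoPlus2p D Δ ℓ n j * qForm2pA F D (zMono (Δ + (n : ℝ)) j)) ^ 2 =
        rhoPlus2p D Δ ℓ n j ^ 2 * qForm2pA F D (zMono (Δ + (n : ℝ)) j) ^ 2 := by ring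
    have e₂ : 4 * pForm2p F D (zMono (Δ + (n : ℝ)) j) * (rhoPlus2p D Δ ℓ n j ^ 2 * dom2mTerm F D (Δ + (n : ℝ)) j) =
        rhoPlus2p D Δ ℓ n j ^ 2 * (4 * pForm2p F D (zMono (Δ + (n : ℝ)) j) * dom2mTerm F D (Δ + (n : ℝ)) j) := by
      ring
    rw [e₁, e₂]
    exact h
  have h := binForm_nonneg hA hC' hB' b z
  unfold dom2pTermForm
  linarith

/-- **Pairs series of `P[g^{0,0}]`** at a regular point: coefficients `A_{n,j}(0,0)/λ_ℓ`.
[cite: HogervorstRychkov2013, §3 eqs. (3.6), (3.9)] [cite: KosPolandSimmonsduffin2014, §3.3 eq. (3.16)] -/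
theorem hasSum_pForm2p (F : ScanFunctional) (D : Dims) {Δ : ℝ} {ℓ : ℕ} {H : ℝ → ℝ → ℝ}
    (hΔ : unitarityBound3D ℓ < Δ) (hreg : ¬ accidentalDegeneracy3D Δ ℓ) (hH : IsConformalBlock3D 0 0 Δ ℓ H) :
    HasSum (fun q : ℕ × ℕ => hrCoeff Δ ℓ q.1 q.2 / legendreLam ℓ * pForm2p F D (zMono (Δ + (q.1 : ℝ)) q.2))
      (pForm2p F D H) := by
  have P := fun (r : Fin 22) (x sgn : ℝ) =>
    hasSum_pointFunctional_crossF_hrZ (fun m => F.w m r) F.z F.zb F.hz F.hzb x sgn hΔ hreg hH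
  have hsum := ((P 1 (D.expo .φφφφ) (-1)).mul_left 2).add ((P 2 (D.expo .φφφφ) 1).mul_left 2)
  refine hsum.congr_fun fun q => ?_
  simp only [pForm2p, nodeEval]
  ring

/-- **Aligned pairs series of `Q[g^{0,−d′}] = Q♮[g^{0,d′}]`** strictly above the bound (`Δ ≠ 1` if `ℓ = 0`):
coefficients `A_{n,j}(0, d′/2)/λ_ℓ` on the SHIFTED monomial functionals `Q♮[𝒫_{Δ+n,j}]`, by conjugation and the
general-ordering series. [cite: DolanOsborn2011, §2 eqs. (2.43)–(2.44)] [cite: DolanOsborn2004, §3 eqs. (3.10)–(3.11)]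
[cite: KosPolandSimmonsduffin2014, §3.3 eq. (3.16)] -/
theorem hasSum_qForm2p (F : ScanFunctional) (D : Dims) {Δ : ℝ} {ℓ : ℕ} {H : ℝ → ℝ → ℝ}
    (hΔ : unitarityBound3D ℓ < Δ) (h1 : ℓ = 0 → Δ ≠ 1)
    (hH : IsConformalBlock3D 0 (-(D.Δt - D.Δs)) Δ ℓ H) :
    HasSum (fun q : ℕ × ℕ => hrCoeffAB 0 ((D.Δt - D.Δs) / 2) Δ ℓ q.1 q.2 / legendreLam ℓ *
        qForm2pA F D (zMono (Δ + (q.1 : ℝ)) q.2)) (qForm2p F D H) := by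
  have hH' := conj_φφst hH
  have P := fun (r : Fin 22) (x sgn : ℝ) =>
    hasSum_pointFunctional_crossF_hrZAB_general (fun m => F.w m r) F.z F.zb F.hz F.hzb x sgn hΔ h1 hH'
  have hsum := ((P 20 (D.expo .φφst + (D.Δt - D.Δs) / 2) (-1)).mul_left 2).sub
    ((P 21 (D.expo .φφst + (D.Δt - D.Δs) / 2) 1).mul_left 2)
  rw [neg_zero, zero_div] at hsum
  rw [qForm2p_eq_qForm2pA]
  refine hsum.congr_fun fun q => ?_
  simp only [qForm2pA, nodeEval]
  ring

/-- **The rank-one rewriting of the aligned coefficient families** at level `(n,j)`: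
`A(d′/2,d′/2) = A(0,0) ρ₊²`, `A(0,d′/2) = A(0,0) ρ₊` (strictly above the bound, `Δ ≠ 1` if `ℓ = 0`).
[cite: DolanOsborn2004, §3 eq. (3.11)] -/
theorem coeffs2p_eq (D : Dims) {Δ : ℝ} {ℓ : ℕ} (hΔ : unitarityBound3D ℓ < Δ) (h1 : ℓ = 0 → Δ ≠ 1)
    (n j : ℕ) :
    hrCoeffAB ((D.Δt - D.Δs) / 2) ((D.Δt - D.Δs) / 2) Δ ℓ n j = hrCoeff Δ ℓ n j * rhoPlus2p D Δ ℓ n j ^ 2 ∧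
      hrCoeffAB 0 ((D.Δt - D.Δs) / 2) Δ ℓ n j = hrCoeff Δ ℓ n j * rhoPlus2p D Δ ℓ n j := by
  have hP := (doPochFactor_zero_zero_pos hΔ h1 n j).ne'
  have h0 := doPochHalf_zero_ne_zero hP
  refine ⟨?_, ?_⟩
  · rw [hrCoeffAB_eq_hrCoeff_mul_doPochRatio hP, rhoPlus2p, sq, mul_assoc]
  · rw [hrCoeffAB_eq_hrCoeff_mul_doPochRatio hP, doPochRatio_zero h0, mul_one, rhoPlus2p]

/-- **Pairs series of the dominated `2⁺` form**: `𝔇₂₊(b,z) = Σ_{(n,j)} (A_{n,j}(0,0)/λ_ℓ) 𝔗_{n,j}(b,z)` at a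
regular point above the bound (`Δ ≠ 1` if `ℓ = 0`), ALIGNED. [cite: DolanOsborn2004, §3 eqs. (3.10)–(3.11)]
[cite: DolanOsborn2011, §2 eqs. (2.43)–(2.44)] [cite: HogervorstRychkov2013, §3 eqs. (3.6), (3.9)]
[cite: KosPolandSimmonsduffin2014, §3.3 eq. (3.16)] -/
theorem hasSum_dom2pForm (F : ScanFunctional) (D : Dims) {Δ : ℝ} {ℓ : ℕ} {G : Label → ℝ → ℝ → ℝ}
    (hΔ : unitarityBound3D ℓ < Δ) (hreg : ¬ accidentalDegeneracy3D Δ ℓ) (h1 : ℓ = 0 → Δ ≠ 1)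
    (hG₀ : IsConformalBlock3D 0 0 Δ ℓ (G .φφφφ))
    (hG₂ : IsConformalBlock3D (-(D.Δt - D.Δs)) (D.Δt - D.Δs) Δ ℓ (G .stts))
    (hG₃ : IsConformalBlock3D 0 (-(D.Δt - D.Δs)) Δ ℓ (G .φφst)) (b z : ℝ) :
    HasSum (fun q : ℕ × ℕ => hrCoeff Δ ℓ q.1 q.2 / legendreLam ℓ * dom2pTermForm F D Δ ℓ q.1 q.2 b z)
      (dom2pForm F D G b z) := by
  have hP := hasSum_pForm2p F D hΔ hreg hG₀
  have hDm := hasSum_dom2mEval F D hΔ hreg hG₂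
  have hQ := hasSum_qForm2p F D hΔ h1 hG₃
  have hsum := ((hP.mul_left (b ^ 2)).add (hDm.mul_left (z ^ 2))).add (hQ.mul_left (b * z))
  rw [dom2pForm]
  refine hsum.congr_fun fun q => ?_
  obtain ⟨e₁, e₂⟩ := coeffs2p_eq D hΔ h1 q.1 q.2
  simp only [dom2pTermForm]
  rw [e₁, e₂]
  ring

/-- **`𝔇₂₊(b,z) ≥ 0` from a finite head + non-negative tail term forms** (regular point above the bound,
`Δ ≠ 1` if `ℓ = 0`). [cite: HogervorstRychkov2013, §3 eqs. (3.6), (3.9)] [cite: KosPolandSimmonsduffin2014, §3.3 eq. (3.16)]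
[cite: DolanOsborn2004, §3 eq. (3.11)] -/
theorem dom2pForm_nonneg_of_termwise (F : ScanFunctional) (D : Dims) {Δ : ℝ} {ℓ : ℕ}
    (hΔ : unitarityBound3D ℓ < Δ) (hreg : ¬ accidentalDegeneracy3D Δ ℓ) (h1 : ℓ = 0 → Δ ≠ 1)
    (S : Finset (ℕ × ℕ))
    (hhead : ∀ b z : ℝ, 0 ≤ ∑ q ∈ S, hrCoeff Δ ℓ q.1 q.2 / legendreLam ℓ * dom2pTermForm F D Δ ℓ q.1 q.2 b z)
    (htail : ∀ q : ℕ × ℕ, q ∉ S → InDescendantRange ℓ q.1 q.2 →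
      ∀ b z : ℝ, 0 ≤ dom2pTermForm F D Δ ℓ q.1 q.2 b z)
    {G : Label → ℝ → ℝ → ℝ} (hG₀ : IsConformalBlock3D 0 0 Δ ℓ (G .φφφφ))
    (hG₂ : IsConformalBlock3D (-(D.Δt - D.Δs)) (D.Δt - D.Δs) Δ ℓ (G .stts))
    (hG₃ : IsConformalBlock3D 0 (-(D.Δt - D.Δs)) Δ ℓ (G .φφst)) (b z : ℝ) :
    0 ≤ dom2pForm F D G b z := by
  have hS := hasSum_dom2pForm F D hΔ hreg h1 hG₀ hG₂ hG₃ b z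
  refine (hhead b z).trans (sum_le_hasSum S (fun q hq => ?_) hS)
  by_cases hr : InDescendantRange ℓ q.1 q.2
  · exact mul_nonneg (div_nonneg (hrCoeff_nonneg hΔ _ _) (legendreLam_pos ℓ).le) (htail q hq hr b z)
  · rw [hrCoeff_eq_zero_of_not_inDescendantRange Δ hr, zero_div, zero_mul]

/-- `Pos2p` of a scan functional from nonnegativity of the `2⁺` sector form on genuine `z`-coordinate blocks.
[cite: ChesterEtAl2020, §3.1 ("`M ⪰ 0`")] [cite: KosPolandSimmonsduffin2014, §3.3 eq. (3.16)] -/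
theorem pos2p_of_forall_sector2pForm_nonneg (F : ScanFunctional) (D : Dims) {Δ : ℝ} {ℓ : ℕ}
    (h : ∀ G : Label → ℝ → ℝ → ℝ, (∀ L ∈ labels2p, IsConformalBlock3D (d12 D L) (d34 D L) Δ ℓ (G L)) →
      ∀ b z : ℝ, 0 ≤ sector2pForm F D G b z) :
    Pos2p F.toFunctional D Δ ℓ := by
  intro g hg
  refine PosSemidef.of_dotProduct_mulVec_nonneg (isHermitian_alphaMat _ (V2p_transpose D g)) fun x => ?_
  have hx : x = ![x 0, x 1] := by
    funext i; fin_cases i <;> rfl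
  rw [star_trivial, hx, sector2pForm_eq]
  exact h _ (blocks_of_genuineOn_labels2p hg) _ _

/-- **Sector `2⁺` at a regular `(Δ, ℓ)` from termwise domination**: a finite head
`Σ_{q ∈ S} (A_q(0,0)/λ_ℓ) 𝔗_q(b,z) ≥ 0` for all `(b, z)` and every tail term form `𝔗_q ≥ 0` for all `(b, z)`
(e.g. by `dom2pTermForm_nonneg_of_test`) give `α(V⃗_{2⁺,Δ,ℓ}) ⪰ 0` (`Δ` above the bound, no accidental
degeneracy, `Δ ≠ 1` if `ℓ = 0`). [cite: PappadopuloRychkovEspinRattazzi2012, §5]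
[cite: KosPolandSimmonsduffin2014, §3.3 eq. (3.16)] [cite: ChesterEtAl2020, §3.1 (functional conditions)]
[cite: DolanOsborn2004, §3 eq. (3.11)] -/
theorem pos2p_of_dom_termwise (F : ScanFunctional) (D : Dims) {Δ : ℝ} {ℓ : ℕ}
    (hΔ : unitarityBound3D ℓ < Δ) (hreg : ¬ accidentalDegeneracy3D Δ ℓ) (h1 : ℓ = 0 → Δ ≠ 1)
    (S : Finset (ℕ × ℕ))
    (hhead : ∀ b z : ℝ, 0 ≤ ∑ q ∈ S, hrCoeff Δ ℓ q.1 q.2 / legendreLam ℓ * dom2pTermForm F D Δ ℓ q.1 q.2 b z)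
    (htail : ∀ q : ℕ × ℕ, q ∉ S → InDescendantRange ℓ q.1 q.2 →
      ∀ b z : ℝ, 0 ≤ dom2pTermForm F D Δ ℓ q.1 q.2 b z) :
    Pos2p F.toFunctional D Δ ℓ :=
  pos2p_of_forall_sector2pForm_nonneg F D fun _ hG b z => by
    obtain ⟨h₀, hts, hst, hφst⟩ := blocks2p_of_forall hG
    exact (dom2pForm_nonneg_of_termwise F D hΔ hreg h1 S hhead htail h₀ hst hφst b z).trans
      (dom2pForm_le_sector2pForm F D hΔ hreg h1 hts hst b z)

/-- **Fully termwise form, sector `2⁺`.** [cite: PappadopuloRychkovEspinRattazzi2012, §5]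
[cite: ChesterEtAl2020, §3.1 (functional conditions)] [cite: DolanOsborn2004, §3 eq. (3.11)] -/
theorem pos2p_of_dom_forall (F : ScanFunctional) (D : Dims) {Δ : ℝ} {ℓ : ℕ}
    (hΔ : unitarityBound3D ℓ < Δ) (hreg : ¬ accidentalDegeneracy3D Δ ℓ) (h1 : ℓ = 0 → Δ ≠ 1)
    (hterm : ∀ q : ℕ × ℕ, InDescendantRange ℓ q.1 q.2 → ∀ b z : ℝ, 0 ≤ dom2pTermForm F D Δ ℓ q.1 q.2 b z) :
    Pos2p F.toFunctional D Δ ℓ :=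
  pos2p_of_dom_termwise F D hΔ hreg h1 ∅ (by simp) (fun q _ hr => hterm q hr)

/-! ### §4 Non-regular points by right limits -/

/-- The `2⁺` sector form is continuous along pointwise convergence of the four blocks on the open square.
Elementary (finitely many node values). [cite: KosPolandSimmonsduffin2014, §4 eqs. (4.2)–(4.3)] -/
theorem tendsto_sector2pForm (F : ScanFunctional) (D : Dims) (Gf : ℝ → Label → ℝ → ℝ → ℝ)
    (G : Label → ℝ → ℝ → ℝ) (l : Filter ℝ)
    (hG : ∀ L ∈ labels2p, ∀ x y : ℝ, x ∈ Ioo (0 : ℝ) 1 → y ∈ Ioo (0 : ℝ) 1 →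
      Tendsto (fun Δ' => Gf Δ' L x y) l (𝓝 (G L x y))) (b z : ℝ) :
    Tendsto (fun Δ' => sector2pForm F D (Gf Δ') b z) l (𝓝 (sector2pForm F D G b z)) := by
  have T := fun (r : Fin 22) (x sgn : ℝ) {L : Label} (hL : L ∈ labels2p) =>
    tendsto_pointFunctional_crossF (fun m => F.w m r) F.z F.zb F.hz F.hzb x sgn (fun Δ' => Gf Δ' L) (G L) l
      (hG L hL)
  have h₀ : Label.φφφφ ∈ labels2p := by simp [labels2p]
  have h₁ : Label.tsts ∈ labels2p := by simp [labels2p]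
  have h₂ : Label.stts ∈ labels2p := by simp [labels2p]
  have h₃ : Label.φφst ∈ labels2p := by simp [labels2p]
  simp only [sector2pForm, pForm2p, rForm2p, qForm2p, nodeEval]
  exact (((((T 1 (D.expo .φφφφ) (-1) h₀).const_mul 2).add ((T 2 (D.expo .φφφφ) 1 h₀).const_mul 2)).const_mul
        (b ^ 2)).add
      (((((T 14 (D.expo .tsts) (-1) h₁).const_mul 2).add ((T 15 (D.expo .stts) (-1) h₂).const_mul 2)).sub
        ((T 16 (D.expo .stts) 1 h₂).const_mul 2)).const_mul (z ^ 2))).add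
    ((((T 20 (D.expo .φφst) (-1) h₃).const_mul 2).sub ((T 21 (D.expo .φφst) 1 h₃).const_mul 2)).const_mul
      (b * z))

/-- **Sector `2⁺` at a NON-REGULAR point from the right**: if `(Δ, ℓ)` is not regular and, for all `Δ'` in a
right neighbourhood, `(Δ', ℓ)` is regular and the `2⁺` sector form is `≥ 0` on genuine blocks at `(Δ', ℓ)` for
every `(b, z)` (e.g. by `pos2p_of_dom_termwise`'s inner estimate; `Δ' ≠ 1` eventually), then `Pos2p` at
`(Δ, ℓ)`. [cite: KosPolandSimmonsduffin2014, §4 eqs. (4.2)–(4.3)] [cite: ChesterEtAl2020, §3.1 (functional conditions)] -/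
theorem pos2p_of_eventually_right (F : ScanFunctional) (D : Dims) {Δ : ℝ} {ℓ : ℕ}
    (hΔ : ¬ IsRegularPoint3D Δ ℓ)
    (h : ∀ᶠ Δ' in 𝓝[>] Δ, IsRegularPoint3D Δ' ℓ ∧ ∀ G : Label → ℝ → ℝ → ℝ,
      (∀ L ∈ labels2p, IsConformalBlock3D (d12 D L) (d34 D L) Δ' ℓ (G L)) →
      ∀ b z : ℝ, 0 ≤ sector2pForm F D G b z) :
    Pos2p F.toFunctional D Δ ℓ := by
  refine pos2p_of_forall_sector2pForm_nonneg F D fun G hG b z => ?_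
  obtain ⟨Gf, hGa, hGl⟩ := exists_approximants_of_not_isRegularPoint3D' hΔ labels2p (d12 D) (d34 D) hG
  have hlim := tendsto_sector2pForm F D Gf G (𝓝[>] Δ) hGl b z
  refine ge_of_tendsto hlim ?_
  have hIoo : Ioo Δ (Δ + 1) ∈ 𝓝[>] Δ := Ioo_mem_nhdsGT (by linarith)
  filter_upwards [h, hIoo] with Δ' hΔ' hmem
  exact hΔ'.2 (Gf Δ') (fun L hL => Or.inl ⟨hΔ'.1, hGa L hL Δ' hmem⟩) b z

/-- **The regular-point estimate packaged for the right-limit rule**: at a regular `(Δ', ℓ)` above the bound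
with `Δ' ≠ 1` if `ℓ = 0`, head + tail termwise nonnegativity gives the `2⁺` sector form `≥ 0` on genuine blocks
for every `(b, z)`. [cite: PappadopuloRychkovEspinRattazzi2012, §5] [cite: DolanOsborn2004, §3 eq. (3.11)] -/
theorem sector2pForm_nonneg_of_dom_termwise (F : ScanFunctional) (D : Dims) {Δ : ℝ} {ℓ : ℕ}
    (hΔ : unitarityBound3D ℓ < Δ) (hreg : ¬ accidentalDegeneracy3D Δ ℓ) (h1 : ℓ = 0 → Δ ≠ 1)
    (S : Finset (ℕ × ℕ))
    (hhead : ∀ b z : ℝ, 0 ≤ ∑ q ∈ S, hrCoeff Δ ℓ q.1 q.2 / legendreLam ℓ * dom2pTermForm F D Δ ℓ q.1 q.2 b z)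
    (htail : ∀ q : ℕ × ℕ, q ∉ S → InDescendantRange ℓ q.1 q.2 →
      ∀ b z : ℝ, 0 ≤ dom2pTermForm F D Δ ℓ q.1 q.2 b z)
    {G : Label → ℝ → ℝ → ℝ} (hG : ∀ L ∈ labels2p, IsConformalBlock3D (d12 D L) (d34 D L) Δ ℓ (G L))
    (b z : ℝ) : 0 ≤ sector2pForm F D G b z := by
  obtain ⟨h₀, hts, hst, hφst⟩ := blocks2p_of_forall hG
  exact (dom2pForm_nonneg_of_termwise F D hΔ hreg h1 S hhead htail h₀ hst hφst b z).trans
    (dom2pForm_le_sector2pForm F D hΔ hreg h1 hts hst b z)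

end Literature.MathematicalPhysics.QuantumFieldTheory.O2ChargeTwoEvenTermwise
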